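import Summits.MatrixMultiplication.OmegaCensus.STPP211Z2pow5RoomReflectA

/-!
# (2,1,1)⁶ in (ℤ/2)⁵ — the X-ROOM CERTIFICATE, part C2: reflection — the engine is sound

Cell `pub-omega` (unit `pub-omega-stpp-1-g35`), topic `Summits/MatrixMultiplication/OmegaCensus`.
HONEST FRAMING (verbatim): lottery ticket; floor = certified bounds/negative ranges. Census STRUCTURE bookkeeping (B5, T1 column at `(ℤ/2)⁵`;
ROOM mechanism class of X-38); nothing here is a bound on `ω`.

SOUNDNESS OF `T1Z2p5.go` (`STPP211Z2pow5RoomEngine`): if the tables `ts` pass the one-sided table check `checkTabs C ts` and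
`go ts 0 0 = true`, then EVERY translation-normal-form STPP family `Aᵢ = {aᵢ, qᵢ}`, `Bᵢ = {0}`, `Cᵢ = {cᵢ}` of `𝔽₂⁵` with
`enc (c i) = C[i]` and `enc (a i) < enc (q i)` has X-room set `T1Room.roomX = univ` (`roomX_eq_univ_of_go`): one step along the true
branch (`go_step`: the prune passes, both true points are candidates, the pair test does not fire, the continuation is the next state),
six steps, and the leaf (`roomX_of_leaf`: `F1 = 2³² − 1` read one-sidedly puts every element `(0 − cⱼ) + (c_l − x)` in the X-room set).
Lemmas in part C1 (`STPP211Z2pow5RoomReflectA`).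

References: H. Cohn, R. Kleinberg, B. Szegedy, C. Umans, FOCS 2005 (arXiv:math/0511460), Def. 5.1.
-/

namespace Summit.MatrixMultiplication.OmegaCensus

namespace T1Z2p5

open Finset STPP211Neg Literature.Computability.AlgebraicComplexity T1Room

variable {a q c : Fin 6 → G5} {C ts : List ℕ}

/-! ## One step along the true branch, the leaf, the theorem -/

/-- ONE STEP: if the engine accepts from the state of `m` placed blocks, it accepts from the state of `m + 1`. -/
theorem go_step (hS : IsSTPP (fun i => ({a i, q i} : Finset G5)) (fun _ => {0}) (fun i => {c i})) (haq : ∀ i, enc (a i) < enc (q i)) (htab : checkTabs C ts = true) (hC : C.length = 6) (hts : ts.length = 6) (hc : ∀ i : Fin 6, C.getD i.val 0 = enc (c i)) {m : ℕ} (hm : m < 6)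
    (h : go (ts.drop m) (usedM a q m) (F1M ts a q m) = true) :
    go (ts.drop (m + 1)) (usedM a q (m + 1)) (F1M ts a q (m + 1)) = true := by
  have hmlen : m < ts.length := by rw [hts]; exact hm
  have hdrop : ts.drop m = ts.getD m 0 :: ts.drop (m + 1) := by
    rw [List.drop_eq_getElem_cons hmlen, List.getD_eq_getElem _ _ hmlen]
  rw [hdrop, go_cons] at h
  have hlen : (ts.drop (m + 1)).length = 5 - m := by rw [List.length_drop, hts]; omega
  rw [hlen, hasBits_R hS haq htab hC hc hm, Bool.not_true, Bool.false_or] at h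
  set T := ts.getD m 0 with hT
  set U := usedM a q m with hU
  set F := F1M ts a q m with hF
  set S := Nat.land (cpl (Nat.lor U F)) (cpl (spread T U)) with hSdef
  -- the two true points are candidates
  have hSmem : ∀ x : G5, (x = a ⟨m, hm⟩ ∨ x = q ⟨m, hm⟩) → S.testBit (enc x) = true := by
    intro x hx
    rw [hSdef, land_eq, Nat.testBit_land, hU, hF, mem_R hS htab hC hc (i := ⟨m, hm⟩) le_rfl hx, Bool.true_and, testBit_cpl]
    refine ⟨enc_lt x, ?_⟩
    by_contra hsp
    rw [Bool.not_eq_false] at hsp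
    obtain ⟨z, hz, hfz⟩ := spread_spec hsp
    obtain ⟨l, hl, hzl⟩ := usedM_spec m z hz
    have hml : (⟨m, hm⟩ : Fin 6) ≠ l := fun e => by rw [← e] at hl; exact lt_irrefl _ hl
    have hz32 : z < 32 := by rcases hzl with e | e <;> rw [e] <;> exact enc_lt _
    obtain ⟨j, hj, hzj⟩ := checkTabs_spec htab (i := m) (by rw [hC]; exact hm) hz32 hfz
    rw [hC] at hj
    rw [hc ⟨m, hm⟩, hc ⟨j, hj⟩] at hzj
    rcases hzl with e | e
    · rw [e, ← enc_add, ← enc_add] at hzj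
      exact not_room' hS hml hx (Or.inl rfl) hzj
    · rw [e, ← enc_add, ← enc_add] at hzj
      exact not_room' hS hml hx (Or.inr rfl) hzj
  have h1 := allBits_spec _ _ _ le_rfl h (enc (a ⟨m, hm⟩)) (hSmem _ (Or.inl rfl))
  set S2 := Nat.land S (Nat.xor full5 (lowMask (Nat.add (enc (a ⟨m, hm⟩)) 1))) with hS2
  have hS2mem : S2.testBit (enc (q ⟨m, hm⟩)) = true := by
    rw [hS2, land_eq, Nat.testBit_land, hSmem _ (Or.inr rfl), Bool.true_and, xor_eq, Nat.testBit_xor, testBit_full5, add_eq', testBit_lowMask]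
    have h1' := haq ⟨m, hm⟩
    have h2' := enc_lt (q ⟨m, hm⟩)
    rw [decide_eq_true h2', decide_eq_false (by omega)]
    rfl
  have h2 := allBits_spec _ _ _ le_rfl h1 (enc (q ⟨m, hm⟩)) hS2mem
  rw [Bool.or_eq_true] at h2
  rcases h2 with h2 | h2
  · -- the pair test cannot fire on the true pair
    exfalso
    obtain ⟨j, hj, hzj⟩ := checkTabs_spec htab (i := m) (by rw [hC]; exact hm) (by norm_num) h2
    rw [hC] at hj
    rw [hc ⟨m, hm⟩, hc ⟨j, hj⟩] at hzj
    exact pair_ok hS haq hzj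
  · -- the continuation is the state of `m + 1` blocks
    have hU' : usedM a q (m + 1) = Nat.lor (Nat.lor U (bit (enc (a ⟨m, hm⟩)))) (bit (enc (q ⟨m, hm⟩))) := by
      rw [hU]; simp only [usedM, hm, dif_pos]
    have hF' : F1M ts a q (m + 1) = Nat.lor (Nat.lor F (fld T (enc (a ⟨m, hm⟩)))) (fld T (enc (q ⟨m, hm⟩))) := by
      rw [hF, hT]; simp only [F1M, hm, dif_pos]
    rw [hU', hF']
    exact h2

/-- THE LEAF: after six blocks the verdict is `F1 = 2³² − 1`, so every element lies in the X-room set. -/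
theorem roomX_of_leaf (htab : checkTabs C ts = true) (hC : C.length = 6) (hts : ts.length = 6) (hc : ∀ i : Fin 6, C.getD i.val 0 = enc (c i))
    (h : go (ts.drop 6) (usedM a q 6) (F1M ts a q 6) = true) :
    roomX (fun i => ({a i, q i} : Finset G5)) (fun _ => {0}) (fun i => {c i}) = univ := by
  have hnil : ts.drop 6 = [] := List.drop_of_length_le (by rw [hts])
  rw [hnil] at h
  have hF : F1M ts a q 6 = full5 := Nat.eq_of_beq_eq_true h
  ext g
  simp only [mem_univ, iff_true]
  have hz : (F1M ts a q 6).testBit (enc g) = true := by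
    rw [hF, testBit_full5]; exact decide_eq_true (enc_lt g)
  obtain ⟨l, _, j, x, hx, hz⟩ := F1M_spec htab hC hc 6 _ hz
  have hg : g = x + c l + c j := enc_injective hz
  rw [mem_roomX]
  refine ⟨j, l, 0, mem_singleton_self _, c j, mem_singleton_self _, c l, mem_singleton_self _, x, ?_, ?_⟩
  · rcases hx with e | e <;> rw [e] <;> simp
  · rw [hg, sub_eq_add5, sub_eq_add5]; abel

/-- **SOUNDNESS OF THE ENGINE.** If the tables pass the one-sided check and `go ts 0 0 = true`, every translation-normal-form STPP
family of `𝔽₂⁵` with these `c`-codes (pairs oriented by code) has X-room set `⋃ⱼₗ ((Bⱼ − Cⱼ) + (C_l − A_l)) = univ`.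
[cite: CohnKleinbergSzegedyUmans2005, Def. 5.1] -/
theorem roomX_eq_univ_of_go (hS : IsSTPP (fun i => ({a i, q i} : Finset G5)) (fun _ => {0}) (fun i => {c i})) (haq : ∀ i, enc (a i) < enc (q i)) (htab : checkTabs C ts = true) (hC : C.length = 6) (hts : ts.length = 6) (hc : ∀ i : Fin 6, C.getD i.val 0 = enc (c i))
    (h : go ts 0 0 = true) : roomX (fun i => ({a i, q i} : Finset G5)) (fun _ => {0}) (fun i => {c i}) = univ := by
  have h0 : go (ts.drop 0) (usedM a q 0) (F1M ts a q 0) = true := h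
  have h6 := go_step hS haq htab hC hts hc (by norm_num) (go_step hS haq htab hC hts hc (by norm_num)
    (go_step hS haq htab hC hts hc (by norm_num) (go_step hS haq htab hC hts hc (by norm_num)
    (go_step hS haq htab hC hts hc (by norm_num) (go_step hS haq htab hC hts hc (by norm_num) h0)))))
  exact roomX_of_leaf htab hC hts hc h6

end T1Z2p5

end Summit.MatrixMultiplication.OmegaCensus
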